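import Summits.CriticalPhenomena.PercolationContinuityZ3.Theorems.PercNearOneGluingNoHeavyQuantFarSunWitnessAvgSplit
import Summits.CriticalPhenomena.PercolationContinuityZ3.Theorems.PercNearOneGluingNoHeavyQuantFarSunHairChernoff
import Mathlib.Analysis.Complex.ExponentialBounds
import Mathlib.Algebra.BigOperators.Group.Finset.Powerset
import HarnessLib

/-!
# FAR beyond trees: CENTRAL positions and their flank efficiency — the per-position half of "`Σ h ≥ 14 ⇒ G_avg ≥ 1`"

builds on p205010 (kernel theorem, internal audit signed; external expert review pending)

Support file (`--supports stmt-CriticalPhenomena-4575`), seat `prim-cert-1` (gen 37); memo `prim-cert-1/FROM-prim-cert-1-g37-SURPLUS-FAR.md` §7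
(LEMMA 1, steps (iii)–(v)).  Layer `j = 2`.  A position `k < K` is CENTRAL if the hair mass strictly on each side is at least `3`
(`3 ≤ Σ_{i<k} h i` and `3 ≤ Σ_{k<i<K} h i`).  With `h⁰ = update h k 0` (hair `k` removed) the FLANK EFFICIENCY of `k` is
`bo_k = Σ_{Q ⊆ range K} hairW K h⁰ Q · g(#(Q ∩ [0,k)), #(Q ∩ (k,K)))`, `g(a,b) = 𝟙[a ≥ 2, b ≥ 2]/(a+b+1)`
(a lower bound for the kernel mass hair `k` would carry if opened: `1/#wit ≥ 1/(#Q+1)`).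

* `HairyCycle.sum_central_compl_lt` / **`HairyCycle.card_central_gt`** — the non-central positions carry hair mass `< 8`, so there are
  more than `Σ − 8` central positions.
* `HairyCycle.flankMass_ge` — for a central position, `P(A_k ≥ 2) ≥ p₀ := 0.5938` (Chernoff at `θ = 1/3`: `P(A_k ≤ 1) ≤ 3e^{−2}`), same on the right.
* **`HairyCycle.flankEff_ge`** — for a central position, `bo_k · (Σ + p₀) ≥ p₀³` (joint law = product, Cauchy–Schwarz, means `≤ Σ_L, Σ_R`).
No definitions, no sorries, standard axioms.  Elementary [this work].
-/

noncomputable section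

namespace Summit.CriticalPhenomena.PercolationContinuityZ3.Theorems.HairyCycle

open Finset
open scoped Classical

variable {K : ℕ}

/-! ## Counting central positions -/

/-- The positions with left mass `< 3` carry total mass `< 4` (`0 ≤ h ≤ 1`). [this work] -/
theorem sum_leftLight_lt {h : ℕ → ℝ} (hh : ∀ k, k < K → 0 ≤ h k ∧ h k ≤ 1) :
    ∑ k ∈ (range K).filter (fun k => ∑ i ∈ range k, h i < 3), h k < 4 := by
  set P := (range K).filter (fun k => ∑ i ∈ range k, h i < 3) with hP
  by_cases hne : P.Nonempty
  · set m := P.max' hne with hm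
    have hmP : m ∈ P := Finset.max'_mem P hne
    rw [hP, Finset.mem_filter, Finset.mem_range] at hmP
    have hsub : P ⊆ range (m + 1) := fun k hk => Finset.mem_range.2 (Nat.lt_succ_of_le (Finset.le_max' P k hk))
    calc ∑ k ∈ P, h k ≤ ∑ k ∈ range (m + 1), h k :=
          Finset.sum_le_sum_of_subset_of_nonneg hsub fun k hk _ => (hh k (by rw [Finset.mem_range] at hk; omega)).1
      _ = ∑ i ∈ range m, h i + h m := Finset.sum_range_succ _ _
      _ < 3 + 1 := by linarith [hmP.2, (hh m hmP.1).2]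
      _ = 4 := by norm_num
  · rw [Finset.not_nonempty_iff_eq_empty.1 hne, Finset.sum_empty]; norm_num

/-- The positions with right mass `< 3` carry total mass `< 4` (`0 ≤ h ≤ 1`). [this work] -/
theorem sum_rightLight_lt {h : ℕ → ℝ} (hh : ∀ k, k < K → 0 ≤ h k ∧ h k ≤ 1) :
    ∑ k ∈ (range K).filter (fun k => ∑ i ∈ (range K).filter (fun i => k < i), h i < 3), h k < 4 := by
  set S := (range K).filter (fun k => ∑ i ∈ (range K).filter (fun i => k < i), h i < 3) with hS
  by_cases hne : S.Nonempty
  · set m := S.min' hne with hm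
    have hmS : m ∈ S := Finset.min'_mem S hne
    rw [hS, Finset.mem_filter, Finset.mem_range] at hmS
    have hsub : S ⊆ insert m ((range K).filter (fun i => m < i)) := by
      intro k hk
      have hmk : m ≤ k := Finset.min'_le S k hk
      rw [Finset.mem_insert, Finset.mem_filter, Finset.mem_range]
      rcases eq_or_lt_of_le hmk with e | hlt
      · exact Or.inl e.symm
      · exact Or.inr ⟨(Finset.mem_range.1 (Finset.mem_filter.1 hk).1), hlt⟩
    have hm_notin : m ∉ (range K).filter (fun i => m < i) := by simp
    calc ∑ k ∈ S, h k ≤ ∑ k ∈ insert m ((range K).filter (fun i => m < i)), h k :=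
          Finset.sum_le_sum_of_subset_of_nonneg hsub fun k hk _ => by
            rw [Finset.mem_insert, Finset.mem_filter, Finset.mem_range] at hk
            rcases hk with rfl | hk
            · exact (hh _ hmS.1).1
            · exact (hh k hk.1).1
      _ = h m + ∑ i ∈ (range K).filter (fun i => m < i), h i := Finset.sum_insert hm_notin
      _ < 1 + 3 := by linarith [hmS.2, (hh m hmS.1).2]
      _ = 4 := by norm_num
  · rw [Finset.not_nonempty_iff_eq_empty.1 hne, Finset.sum_empty]; norm_num

/-- **More than `Σ − 8` central positions.**  With `Cen = {k < K : 3 ≤ Σ_{i<k} h i ∧ 3 ≤ Σ_{k<i<K} h i}`: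
`Σ_{k<K} h k − 8 < #Cen` (`0 ≤ h ≤ 1`). [this work] -/
theorem card_central_gt {h : ℕ → ℝ} (hh : ∀ k, k < K → 0 ≤ h k ∧ h k ≤ 1) :
    ∑ k ∈ range K, h k - 8 <
      (((range K).filter (fun k => 3 ≤ ∑ i ∈ range k, h i ∧ 3 ≤ ∑ i ∈ (range K).filter (fun i => k < i), h i)).card : ℝ) := by
  set Cen := (range K).filter (fun k => 3 ≤ ∑ i ∈ range k, h i ∧ 3 ≤ ∑ i ∈ (range K).filter (fun i => k < i), h i) with hCen
  set P := (range K).filter (fun k => ∑ i ∈ range k, h i < 3) with hP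
  set S := (range K).filter (fun k => ∑ i ∈ (range K).filter (fun i => k < i), h i < 3) with hS
  have hcover : range K \ Cen ⊆ P ∪ S := by
    intro k hk
    rw [Finset.mem_sdiff, hCen, Finset.mem_filter] at hk
    rw [Finset.mem_union, hP, hS, Finset.mem_filter, Finset.mem_filter]
    by_cases h1 : ∑ i ∈ range k, h i < 3
    · exact Or.inl ⟨hk.1, h1⟩
    · right
      refine ⟨hk.1, ?_⟩
      by_contra h2
      exact hk.2 ⟨hk.1, le_of_not_gt h1, le_of_not_gt h2⟩
  have hnn : ∀ k ∈ range K, 0 ≤ h k := fun k hk => (hh k (Finset.mem_range.1 hk)).1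
  have h1 : ∑ k ∈ range K, h k = ∑ k ∈ Cen, h k + ∑ k ∈ range K \ Cen, h k := by
    rw [← Finset.sum_sdiff (Finset.filter_subset _ _ : Cen ⊆ range K)]; ring
  have h2 : ∑ k ∈ range K \ Cen, h k ≤ ∑ k ∈ P ∪ S, h k :=
    Finset.sum_le_sum_of_subset_of_nonneg hcover fun k hk _ => by
      rw [Finset.mem_union, hP, hS] at hk
      rcases hk with hk | hk <;> exact hnn k (Finset.mem_filter.1 hk).1
  have h3 : ∑ k ∈ P ∪ S, h k ≤ ∑ k ∈ P, h k + ∑ k ∈ S, h k := by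
    rw [← Finset.sum_union_inter]
    have : 0 ≤ ∑ k ∈ P ∩ S, h k := Finset.sum_nonneg fun k hk => hnn k (Finset.mem_filter.1 (Finset.mem_inter.1 hk).1).1
    linarith
  have h4 : ∑ k ∈ Cen, h k ≤ (Cen.card : ℝ) := by
    have := Finset.sum_le_sum (s := Cen) (f := h) (g := fun _ => (1 : ℝ)) fun k hk => (hh k (Finset.mem_range.1 (Finset.mem_filter.1 hk).1)).2
    simpa using this
  linarith [sum_leftLight_lt hh, sum_rightLight_lt hh]

/-! ## Flank mass of a central position -/

/-- `e^{−2} ≤ 0.1354`. [folklore] -/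
theorem exp_neg_two_le : Real.exp (-2) ≤ 0.1354 := by
  have h1 := Real.exp_one_gt_d9
  have h2 : Real.exp 2 = Real.exp 1 ^ 2 := by rw [← Real.exp_nat_mul]; norm_num
  have h3 : (7.389 : ℝ) ≤ Real.exp 2 := by rw [h2]; nlinarith
  rw [Real.exp_neg, inv_le_comm₀ (Real.exp_pos 2) (by norm_num)]
  linarith

/-- **Flank mass of a heavy side**: if the hairs of an index set `C` have mass `Σ_{k<K, k∈C} h k ≥ 3`, then
`P(#(Q∩C) ≤ 1) ≤ 0.4062`, i.e. at least two of them are open with probability `≥ 0.5938`. [this work] -/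
theorem sum_hairW_count_le_one_le {h : ℕ → ℝ} (hh : ∀ k, k < K → 0 ≤ h k ∧ h k ≤ 1) (C : Finset ℕ)
    (hC : 3 ≤ ∑ k ∈ (range K).filter (fun k => k ∈ C), h k) :
    ∑ Q ∈ (range K).powerset, hairW K h Q * (if (Q ∩ C).card ≤ 1 then (1 : ℝ) else 0) ≤ 0.4062 := by
  have hc := pow_mul_sum_hairW_count_le_exp hh C 1 (θ := 1 / 3) (by norm_num) (by norm_num)
  have h1 : Real.exp (-(1 - 1 / 3) * ∑ k ∈ (range K).filter (fun k => k ∈ C), h k) ≤ Real.exp (-2) :=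
    Real.exp_le_exp.2 (by nlinarith)
  have h2 := exp_neg_two_le
  rw [pow_one] at hc
  linarith

/-! ## Flank efficiency of a central position -/

/-- Total mass of the count pmf: `Σ_{a ≤ K} M_C(a) = 1`. [this work] -/
theorem sum_countMass_eq_one (h : ℕ → ℝ) (C : Finset ℕ) :
    ∑ a ∈ range (K + 1), ∑ Q ∈ (range K).powerset, hairW K h Q * (if (Q ∩ C).card = a then (1 : ℝ) else 0) = 1 := by
  rw [Finset.sum_comm]
  calc ∑ Q ∈ (range K).powerset, ∑ a ∈ range (K + 1), hairW K h Q * (if (Q ∩ C).card = a then (1 : ℝ) else 0)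
      = ∑ Q ∈ (range K).powerset, hairW K h Q := by
        refine Finset.sum_congr rfl fun Q hQ => ?_
        rw [Finset.mem_powerset] at hQ
        rw [← Finset.mul_sum]
        have ha : (Q ∩ C).card ∈ range (K + 1) := by
          rw [Finset.mem_range]
          have := (Finset.card_le_card (Finset.inter_subset_left (s₁ := Q) (s₂ := C))).trans
            ((Finset.card_le_card hQ).trans (Finset.card_range K).le)
          omega
        rw [Finset.sum_eq_single_of_mem _ ha (fun a _ hne => if_neg (fun e => hne e.symm)), if_pos rfl, mul_one]
    _ = 1 := sum_hairW_eq_one h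

/-- Mass at `≥ 2` is one minus mass at `≤ 1`. [this work] -/
theorem sum_countMass_ge_two (h : ℕ → ℝ) (C : Finset ℕ) :
    ∑ a ∈ (range (K + 1)).filter (fun a => 2 ≤ a), ∑ Q ∈ (range K).powerset, hairW K h Q * (if (Q ∩ C).card = a then (1 : ℝ) else 0) =
      1 - ∑ Q ∈ (range K).powerset, hairW K h Q * (if (Q ∩ C).card ≤ 1 then (1 : ℝ) else 0) := by
  have htot := sum_countMass_eq_one (K := K) h C
  rw [← Finset.sum_filter_add_sum_filter_not (range (K + 1)) (fun a => 2 ≤ a)] at htot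
  have hlow : ∑ a ∈ (range (K + 1)).filter (fun a => ¬ 2 ≤ a), ∑ Q ∈ (range K).powerset, hairW K h Q * (if (Q ∩ C).card = a then (1 : ℝ) else 0) =
      ∑ Q ∈ (range K).powerset, hairW K h Q * (if (Q ∩ C).card ≤ 1 then (1 : ℝ) else 0) := by
    rw [Finset.sum_comm]
    refine Finset.sum_congr rfl fun Q hQ => ?_
    rw [Finset.mem_powerset] at hQ
    rw [← Finset.mul_sum]
    congr 1
    have hcard : (Q ∩ C).card ≤ K :=
      (Finset.card_le_card (Finset.inter_subset_left (s₁ := Q) (s₂ := C))).trans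
        ((Finset.card_le_card hQ).trans (Finset.card_range K).le)
    by_cases h1 : (Q ∩ C).card ≤ 1
    · rw [if_pos h1]
      have hmem : (Q ∩ C).card ∈ (range (K + 1)).filter (fun a => ¬ 2 ≤ a) := by
        rw [Finset.mem_filter, Finset.mem_range]; omega
      rw [Finset.sum_eq_single_of_mem _ hmem (fun a _ hne => if_neg (fun e => hne e.symm)), if_pos rfl]
    · rw [if_neg h1]
      exact Finset.sum_eq_zero fun a ha => by
        rw [Finset.mem_filter] at ha
        rw [if_neg (by omega)]
  linarith

/-- The weighted mean over `a ≥ 2` is at most the mean: `Σ_{a≥2} a·M_C(a) ≤ Σ_{k<K, k∈C} h k`. [this work] -/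
theorem sum_countMass_mul_le_mean {h : ℕ → ℝ} (hh : ∀ k, k < K → 0 ≤ h k ∧ h k ≤ 1) (C : Finset ℕ) :
    ∑ a ∈ (range (K + 1)).filter (fun a => 2 ≤ a), (a : ℝ) * ∑ Q ∈ (range K).powerset, hairW K h Q * (if (Q ∩ C).card = a then (1 : ℝ) else 0) ≤
      ∑ k ∈ (range K).filter (fun k => k ∈ C), h k := by
  rw [← sum_hairW_count_eq_mean h C K]
  calc ∑ a ∈ (range (K + 1)).filter (fun a => 2 ≤ a), (a : ℝ) * ∑ Q ∈ (range K).powerset, hairW K h Q * (if (Q ∩ C).card = a then (1 : ℝ) else 0)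
      ≤ ∑ a ∈ range (K + 1), (a : ℝ) * ∑ Q ∈ (range K).powerset, hairW K h Q * (if (Q ∩ C).card = a then (1 : ℝ) else 0) :=
        Finset.sum_le_sum_of_subset_of_nonneg (Finset.filter_subset _ _) fun a _ _ =>
          mul_nonneg (Nat.cast_nonneg a) (Finset.sum_nonneg fun Q _ => mul_nonneg (hairW_nonneg hh Q) (by split_ifs <;> norm_num))
    _ = ∑ Q ∈ (range K).powerset, hairW K h Q * ((Q ∩ C).card : ℝ) := by
        simp_rw [Finset.mul_sum]
        rw [Finset.sum_comm]
        refine Finset.sum_congr rfl fun Q hQ => ?_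
        rw [Finset.mem_powerset] at hQ
        have ha : (Q ∩ C).card ∈ range (K + 1) := by
          rw [Finset.mem_range]
          have := (Finset.card_le_card (Finset.inter_subset_left (s₁ := Q) (s₂ := C))).trans ((Finset.card_le_card hQ).trans (Finset.card_range K).le)
          omega
        rw [Finset.sum_eq_single_of_mem _ ha (fun a _ hne => by rw [if_neg (Ne.symm hne)]; ring)]
        rw [if_pos rfl]; ring

/-- The algebra behind the flank-efficiency bound: from Cauchy–Schwarz `(π_L π_R)² ≤ X(π_R m_L + π_L m_R + π_L π_R)` and
`p₀ ≤ π ≤ 1`, `m ≤ S`, `S_L + S_R ≤ S`:  `p₀³ ≤ X (S + p₀)`. [this work] -/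
theorem flank_algebra {X πL πR mL mR SL SR S p0 : ℝ} (hp : 0 < p0) (hX0 : 0 ≤ X)
    (hcs : πL ^ 2 * πR ^ 2 ≤ X * (πR * mL + πL * mR + πL * πR))
    (hπL : p0 ≤ πL) (hπR : p0 ≤ πR) (hmL0 : 0 ≤ mL) (hmR0 : 0 ≤ mR) (hmL : mL ≤ SL) (hmR : mR ≤ SR)
    (hS : SL + SR ≤ S) : p0 ^ 3 ≤ X * (S + p0) := by
  have hπL0 : 0 < πL := lt_of_lt_of_le hp hπL
  have hπR0 : 0 < πR := lt_of_lt_of_le hp hπR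
  have hSL0 : 0 ≤ SL := hmL0.trans hmL
  have hSR0 : 0 ≤ SR := hmR0.trans hmR
  set den := πR * SL + πL * SR + πL * πR with hdendef
  have hden0 : 0 < den := by positivity
  have h1 : πL ^ 2 * πR ^ 2 ≤ X * den := by
    refine hcs.trans (mul_le_mul_of_nonneg_left ?_ hX0)
    rw [hdendef]
    linarith [mul_le_mul_of_nonneg_left hmL hπR0.le, mul_le_mul_of_nonneg_left hmR hπL0.le]
  have hq1 : p0 ^ 3 ≤ πL ^ 2 * πR :=
    calc p0 ^ 3 = p0 * p0 * p0 := by ring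
      _ ≤ πL * πL * πR := mul_le_mul (mul_le_mul hπL hπL hp.le hπL0.le) hπR hp.le (mul_nonneg hπL0.le hπL0.le)
      _ = πL ^ 2 * πR := by ring
  have hq2 : p0 ^ 3 ≤ πL * πR ^ 2 :=
    calc p0 ^ 3 = p0 * (p0 * p0) := by ring
      _ ≤ πL * (πR * πR) := mul_le_mul hπL (mul_le_mul hπR hπR hp.le hπR0.le) (by positivity) hπL0.le
      _ = πL * πR ^ 2 := by ring
  have hq3 : p0 ^ 2 ≤ πL * πR :=
    calc p0 ^ 2 = p0 * p0 := by ring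
      _ ≤ πL * πR := mul_le_mul hπL hπR hp.le hπL0.le
  have h2 : p0 ^ 3 * den ≤ πL ^ 2 * πR ^ 2 * (SL + SR + p0) := by
    have e1 : p0 ^ 3 * den = p0 ^ 3 * πR * SL + p0 ^ 3 * πL * SR + p0 ^ 3 * (πL * πR) := by rw [hdendef]; ring
    have e2 : πL ^ 2 * πR ^ 2 * (SL + SR + p0) =
        (πL ^ 2 * πR) * πR * SL + (πL * πR ^ 2) * πL * SR + p0 * ((πL * πR) * (πL * πR)) := by ring
    rw [e1, e2]
    have t1 : p0 ^ 3 * πR * SL ≤ (πL ^ 2 * πR) * πR * SL :=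
      mul_le_mul_of_nonneg_right (mul_le_mul_of_nonneg_right hq1 hπR0.le) hSL0
    have t2 : p0 ^ 3 * πL * SR ≤ (πL * πR ^ 2) * πL * SR :=
      mul_le_mul_of_nonneg_right (mul_le_mul_of_nonneg_right hq2 hπL0.le) hSR0
    have t3 : p0 ^ 3 * (πL * πR) ≤ p0 * ((πL * πR) * (πL * πR)) := by
      have e3 : p0 ^ 3 * (πL * πR) = p0 * (p0 ^ 2 * (πL * πR)) := by ring
      rw [e3]
      exact mul_le_mul_of_nonneg_left (mul_le_mul_of_nonneg_right hq3 (mul_nonneg hπL0.le hπR0.le)) hp.le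
    linarith
  have h3 : p0 ^ 3 * den ≤ X * (SL + SR + p0) * den := by
    have h5 := mul_le_mul_of_nonneg_right h1 (by linarith : (0 : ℝ) ≤ SL + SR + p0)
    have e5 : X * den * (SL + SR + p0) = X * (SL + SR + p0) * den := by ring
    linarith
  have h4 : p0 ^ 3 ≤ X * (SL + SR + p0) := le_of_mul_le_mul_right h3 hden0
  exact h4.trans (mul_le_mul_of_nonneg_left (by linarith) hX0)

/-- **Flank efficiency of a central position.**  Let `0 ≤ h ≤ 1` on `range K`, `k < K` with `3 ≤ Σ_{i<k} h i` and
`3 ≤ Σ_{k<i<K} h i`, `h⁰ = update h k 0`.  Then with `L = range k`, `R = {i < K : k < i}` and `g(a,b) = 𝟙[2 ≤ a, 2 ≤ b]/(a+b+1)`: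
`(Σ_{Q ⊆ range K} hairW K h⁰ Q · g(#(Q∩L), #(Q∩R))) · (Σ_{i<K} h i + 0.5938) ≥ 0.5938³`. [this work] -/
theorem flankEff_ge {h : ℕ → ℝ} (hh : ∀ i, i < K → 0 ≤ h i ∧ h i ≤ 1) {k : ℕ} (hk : k < K)
    (hL : 3 ≤ ∑ i ∈ range k, h i) (hR : 3 ≤ ∑ i ∈ (range K).filter (fun i => k < i), h i) :
    (0.5938 : ℝ) ^ 3 ≤
      (∑ Q ∈ (range K).powerset, hairW K (Function.update h k 0) Q *
        (if 2 ≤ (Q ∩ range k).card ∧ 2 ≤ (Q ∩ (range K).filter (fun i => k < i)).card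
          then 1 / (((Q ∩ range k).card : ℝ) + (Q ∩ (range K).filter (fun i => k < i)).card + 1) else 0)) *
      (∑ i ∈ range K, h i + 0.5938) := by
  have hh0 : ∀ i, i < K → 0 ≤ Function.update h k 0 i ∧ Function.update h k 0 i ≤ 1 := by
    intro i hi
    by_cases hik : i = k
    · rw [hik, Function.update_self]; norm_num
    · rw [Function.update_of_ne hik]; exact hh i hi
  have hLR : Disjoint (range k) ((range K).filter (fun i => k < i)) := by
    rw [Finset.disjoint_left]
    intro i hi hi'
    rw [Finset.mem_range] at hi
    rw [Finset.mem_filter] at hi'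
    omega
  -- joint law
  rw [sum_hairW_fun_two_counts (K := K) (Function.update h k 0) hLR
    (fun a b => if 2 ≤ a ∧ 2 ≤ b then 1 / ((a : ℝ) + b + 1) else 0)]
  -- restrict to `a, b ≥ 2`
  have hX : ∑ a ∈ range (K + 1), ∑ b ∈ range (K + 1),
      (∑ Q ∈ (range K).powerset, hairW K (Function.update h k 0) Q * (if (Q ∩ range k).card = a then (1 : ℝ) else 0)) *
      (∑ Q ∈ (range K).powerset, hairW K (Function.update h k 0) Q * (if (Q ∩ (range K).filter (fun i => k < i)).card = b then (1 : ℝ) else 0)) *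
      (if 2 ≤ a ∧ 2 ≤ b then 1 / ((a : ℝ) + b + 1) else 0) =
      ∑ a ∈ (range (K + 1)).filter (fun a => 2 ≤ a), ∑ b ∈ (range (K + 1)).filter (fun b => 2 ≤ b),
      (∑ Q ∈ (range K).powerset, hairW K (Function.update h k 0) Q * (if (Q ∩ range k).card = a then (1 : ℝ) else 0)) *
      (∑ Q ∈ (range K).powerset, hairW K (Function.update h k 0) Q * (if (Q ∩ (range K).filter (fun i => k < i)).card = b then (1 : ℝ) else 0)) /
      ((a : ℝ) + b + 1) := by
    rw [Finset.sum_filter]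
    refine Finset.sum_congr rfl fun a _ => ?_
    by_cases ha : 2 ≤ a
    · rw [if_pos ha, Finset.sum_filter]
      refine Finset.sum_congr rfl fun b _ => ?_
      by_cases hb : 2 ≤ b
      · rw [if_pos ⟨ha, hb⟩, if_pos hb]; ring
      · rw [if_neg (fun hab => hb hab.2), if_neg hb]; ring
    · rw [if_neg ha]
      exact Finset.sum_eq_zero fun b _ => by rw [if_neg (fun hab => ha hab.1)]; ring
  rw [hX]
  -- means of the sides under `h⁰`
  have hmeanL : ∑ i ∈ (range K).filter (fun i => i ∈ range k), Function.update h k 0 i = ∑ i ∈ range k, h i := by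
    have : (range K).filter (fun i => i ∈ range k) = range k := by
      ext i; rw [Finset.mem_filter, Finset.mem_range, Finset.mem_range]; omega
    rw [this]
    exact Finset.sum_congr rfl fun i hi => by rw [Function.update_of_ne (by rw [Finset.mem_range] at hi; omega)]
  have hmeanR : ∑ i ∈ (range K).filter (fun i => i ∈ (range K).filter (fun i => k < i)), Function.update h k 0 i =
      ∑ i ∈ (range K).filter (fun i => k < i), h i := by
    have : (range K).filter (fun i => i ∈ (range K).filter (fun i => k < i)) = (range K).filter (fun i => k < i) := by
      ext i; simp only [Finset.mem_filter]; tauto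
    rw [this]
    exact Finset.sum_congr rfl fun i hi => by
      rw [Finset.mem_filter] at hi
      rw [Function.update_of_ne (by omega)]
  -- masses `π_L, π_R ≥ p₀` and means `≤ Σ_L, Σ_R`
  have hmassL := sum_countMass_ge_two (K := K) (Function.update h k 0) (range k)
  have hmassR := sum_countMass_ge_two (K := K) (Function.update h k 0) ((range K).filter (fun i => k < i))
  have htailL := sum_hairW_count_le_one_le hh0 (range k) (by rw [hmeanL]; exact hL)
  have htailR := sum_hairW_count_le_one_le hh0 ((range K).filter (fun i => k < i)) (by rw [hmeanR]; exact hR)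
  have hmL := sum_countMass_mul_le_mean hh0 (range k)
  have hmR := sum_countMass_mul_le_mean hh0 ((range K).filter (fun i => k < i))
  rw [hmeanL] at hmL
  rw [hmeanR] at hmR
  have hnnL : ∀ a, 0 ≤ ∑ Q ∈ (range K).powerset, hairW K (Function.update h k 0) Q * (if (Q ∩ range k).card = a then (1 : ℝ) else 0) :=
    fun a => Finset.sum_nonneg fun Q _ => mul_nonneg (hairW_nonneg hh0 Q) (by split_ifs <;> norm_num)
  have hnnR : ∀ b, 0 ≤ ∑ Q ∈ (range K).powerset, hairW K (Function.update h k 0) Q *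
      (if (Q ∩ (range K).filter (fun i => k < i)).card = b then (1 : ℝ) else 0) :=
    fun b => Finset.sum_nonneg fun Q _ => mul_nonneg (hairW_nonneg hh0 Q) (by split_ifs <;> norm_num)
  -- Cauchy–Schwarz
  have hcs := flank_sum_lower_bound K
    (fun a => ∑ Q ∈ (range K).powerset, hairW K (Function.update h k 0) Q * (if (Q ∩ range k).card = a then (1 : ℝ) else 0))
    (fun b => ∑ Q ∈ (range K).powerset, hairW K (Function.update h k 0) Q *
      (if (Q ∩ (range K).filter (fun i => k < i)).card = b then (1 : ℝ) else 0)) hnnL hnnR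
  -- `Σ_L + Σ_R ≤ Σ`
  have hsplit : ∑ i ∈ range k, h i + ∑ i ∈ (range K).filter (fun i => k < i), h i ≤ ∑ i ∈ range K, h i := by
    have hsub : range k ∪ (range K).filter (fun i => k < i) ⊆ range K := by
      intro i hi
      rw [Finset.mem_union, Finset.mem_range, Finset.mem_filter, Finset.mem_range] at hi
      rw [Finset.mem_range]; omega
    calc ∑ i ∈ range k, h i + ∑ i ∈ (range K).filter (fun i => k < i), h i
        = ∑ i ∈ range k ∪ (range K).filter (fun i => k < i), h i := (Finset.sum_union hLR).symm
      _ ≤ ∑ i ∈ range K, h i := Finset.sum_le_sum_of_subset_of_nonneg hsub fun i hi _ => (hh i (Finset.mem_range.1 hi)).1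
  refine flank_algebra (by norm_num) ?_ hcs (by linarith) (by linarith)
    (Finset.sum_nonneg fun a _ => mul_nonneg (Nat.cast_nonneg a) (hnnL a))
    (Finset.sum_nonneg fun b _ => mul_nonneg (Nat.cast_nonneg b) (hnnR b)) hmL hmR hsplit
  exact Finset.sum_nonneg fun a _ => Finset.sum_nonneg fun b _ => div_nonneg (mul_nonneg (hnnL a) (hnnR b)) (by positivity)

end Summit.CriticalPhenomena.PercolationContinuityZ3.Theorems.HairyCycle

end
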